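import Summits.AtomisticToContinuum.Crystallization.Theorems.ContactSaturationLadderGeometricTop
import Literature.Geometry.DiscreteGeometry.SphericalIsoperimetric

/-!
# ContactSaturationLadderAreaTop — the CAP-AREA rung of the floor-7/10 tolerance ladder beneath the residual `NoLooseChunks`
# of crux `LooseTextureRung` is a THEOREM (helper, supports item 30303; lens-1 g33 land twin of node §43 `AreaTop43`, kernels only)

What is proved here (0 sorry; measure theory over the tree's cone measure `Literature.Geometry.DiscreteGeometry.sphereFraction`
and the hat-box formula `sphereFraction_sphCap`, plus the tree reductions of `ContactSaturationLadderGeometricTop`):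

* `sphereFraction_le_sum_of_cover`: finite subadditivity of the normalised cone measure over a finite cover.
* `angle_le_arccos_of_dist_lt_one`: a unit ball meets the sphere `S(c, ρ)` (`ρ ≥ 1`) inside the cap of angular radius
  `arccos (√(ρ²−1)/ρ)` about the direction of its centre.
* **The cap-area covering bound** `ballCoveringBound_of_capArea : 1 ≤ ρ → n·(1 − √(ρ²−1)/ρ) < 2 → BallCoveringBound n ρ`,
  its polynomial form for eleven points `ballCoveringBound_eleven_of_sq : 1 ≤ ρ → 121/40 < ρ² → BallCoveringBound 11 ρ`, and
  `ballCoveringBound_eleven_seven_quarters : BallCoveringBound 11 (7/4)` — discharging the hypothesis of the tree's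
  `noLooseChunksF_2p95_of_area`.
* **The area rung** `noLooseChunksF_areaTop : NoLooseChunksF (59/20)` (the proved top of the floor-7/10 ladder drops from the tree's
  `63/20` (`noLooseChunksF_geoTop`) to `59/20`; sharpest two-decimal grid value `noLooseChunksF_area_grid : NoLooseChunksF (73/25)`),
  the band `bandExclusionF_areaBand : BandExclusionF (59/20) (63/20)`, the exact re-basing of the top piece
  `bandExclusionF_two_top_iff : BandExclusionF 2 (63/20) ↔ BandExclusionF 2 (59/20)`, its exact sub-split through `11/4`
  (`bandExclusionF_two_59_iff`) whose upper factor follows from `BallCoveringBound 11 (8/5)` (`bandExclusionF_fejesTothBand`),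
  and the six-piece grid of the residual with top `59/20` (`noLooseChunks_iff_ladderF6'`).
* **Monotonicity**: `ballCoveringBound_mono` (an up-set in `ρ`, by shrinking about the centre), `ballCoveringBound_anti` (antitone in `n`),
  `ballCoveringBound_eleven_of_ge : 7/4 ≤ ρ → BallCoveringBound 11 ρ`.
* **The method floor**: `not_ballCoveringBound_six : ¬ BallCoveringBound 6 (6/5)` (the octahedron `±(7/10)·eᵢ` comes within `< 1` of
  every point of `S(0, 6/5)`), `not_ballCoveringBound_eleven_of_le`, and `sphereCovering_reduction_void`: the hypothesis of the
  single-sphere reduction `noLooseChunksF_of_ballCoveringBound` is unsatisfiable for slack `(1+δ)·(7/10) ≤ 11/5` (`δ ≤ 15/7`).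

No `def`, no `instance`, no `notation`, no `axiom`, no `sorry`.  Source: lens-1 g33 node `LooseTextureRung_node_g33.lean` §43
(sha256 of record in the g33 MANIFEST), §43.1–§43.6 verbatim; the compositions to `LooseTextureRung` (§43.7) need the node's
§V6/§40 vocabulary and stay node-side.
-/

noncomputable section

namespace Summit.AtomisticToContinuum.Crystallization.Theorems.ContactSaturationLadderAreaTop

open scoped BigOperators Classical
open Metric Set MeasureTheory
open Literature.Geometry.DiscreteGeometry (sphereFraction sphCap rayCone sphereFraction_eq
  sphereFraction_sphCap sphereFraction_sphere)
open Summit.AtomisticToContinuum.Crystallization.Theorems.ContactSaturationLadderChunkDoor (NoLooseChunkAt NoLooseChunks)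
open Summit.AtomisticToContinuum.Crystallization.Theorems.ContactSaturationLadderToleranceFloor
open Summit.AtomisticToContinuum.Crystallization.Theorems.ContactSaturationLadderGeometricTop

/-! ### §43.1 Subadditivity of the normalised cone measure over a finite cover -/

/-- `sphereFraction S ≤ ∑ sphereFraction (T i)` whenever `S ⊆ ⋃_{i ∈ s} T i` (outer-measure
subadditivity of the cone measure; no measurability needed). -/
theorem sphereFraction_le_sum_of_cover {ι : Type*} (s : Finset ι) {S : Set (EuclideanSpace ℝ (Fin 3))}
    {T : ι → Set (EuclideanSpace ℝ (Fin 3))} (hcover : S ⊆ ⋃ i ∈ s, T i) :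
    sphereFraction S ≤ ∑ i ∈ s, sphereFraction (T i) := by
  simp only [sphereFraction_eq]
  rw [← Finset.sum_div]
  refine div_le_div_of_nonneg_right ?_ ENNReal.toReal_nonneg
  have htop : volume (ball (0 : EuclideanSpace ℝ (Fin 3)) 1) ≠ ⊤ := measure_ball_lt_top.ne
  have hfin : ∀ i ∈ s, volume (ball (0 : EuclideanSpace ℝ (Fin 3)) 1 ∩ rayCone (T i)) ≠ ⊤ :=
    fun i _ => (measure_lt_top_of_subset inter_subset_left htop).ne
  have h1 : ball (0 : EuclideanSpace ℝ (Fin 3)) 1 ∩ rayCone S ⊆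
      ⋃ i ∈ s, (ball (0 : EuclideanSpace ℝ (Fin 3)) 1 ∩ rayCone (T i)) := by
    intro x hx
    have hx2 : x ≠ 0 ∧ ‖x‖⁻¹ • x ∈ S := hx.2
    obtain ⟨i, hi, hxi⟩ := mem_iUnion₂.1 (hcover hx2.2)
    exact mem_iUnion₂.2 ⟨i, hi, hx.1, hx2.1, hxi⟩
  calc (volume (ball (0 : EuclideanSpace ℝ (Fin 3)) 1 ∩ rayCone S)).toReal
      ≤ (∑ i ∈ s, volume (ball (0 : EuclideanSpace ℝ (Fin 3)) 1 ∩ rayCone (T i))).toReal :=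
        ENNReal.toReal_mono (ENNReal.sum_ne_top.2 hfin)
          ((measure_mono h1).trans (measure_biUnion_finset_le s _))
    _ = ∑ i ∈ s, (volume (ball (0 : EuclideanSpace ℝ (Fin 3)) 1 ∩ rayCone (T i))).toReal :=
        ENNReal.toReal_sum hfin

/-! ### §43.2 A unit ball cuts `S(c, ρ)` inside a cap of angular radius `arccos (√(ρ²−1)/ρ)` -/

/-- If the point `c + ρ•u` (`‖u‖ = 1`, `ρ ≥ 1`) of the sphere `S(c, ρ)` lies within `< 1` of `z`, then
`z ≠ c` and the direction of `z − c` makes an angle `≤ arccos (√(ρ²−1)/ρ)` with `u`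
(`‖ρu − w‖² < 1` gives `2ρ⟪u,w⟫ > ρ² − 1 + ‖w‖² ≥ 2‖w‖√(ρ²−1)`). -/
theorem angle_le_arccos_of_dist_lt_one {ρ : ℝ} (hρ : 1 ≤ ρ) {c z u : EuclideanSpace ℝ (Fin 3)}
    (hu : ‖u‖ = 1) (h : dist (c + ρ • u) z < 1) :
    z - c ≠ 0 ∧ InnerProductGeometry.angle (z - c) u ≤ Real.arccos (Real.sqrt (ρ ^ 2 - 1) / ρ) := by
  have hρ0 : 0 < ρ := by linarith
  have hdist : dist (c + ρ • u) z = ‖ρ • u - (z - c)‖ := by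
    rw [dist_eq_norm]
    congr 1
    abel
  have hsq : ‖ρ • u - (z - c)‖ ^ 2 = ρ ^ 2 - 2 * ρ * inner ℝ u (z - c) + ‖z - c‖ ^ 2 := by
    rw [norm_sub_sq_real, norm_smul, real_inner_smul_left, Real.norm_eq_abs, abs_of_pos hρ0, hu]
    ring
  have hlt : ‖ρ • u - (z - c)‖ ^ 2 < 1 := by
    rw [← hdist]
    have h0 : 0 ≤ dist (c + ρ • u) z := dist_nonneg
    nlinarith
  rw [hsq] at hlt
  have hw0 : z - c ≠ 0 := by
    intro hw
    rw [hw, inner_zero_right, norm_zero] at hlt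
    nlinarith
  refine ⟨hw0, ?_⟩
  have hs : 0 < ‖z - c‖ := norm_pos_iff.2 hw0
  have ha0 : 0 ≤ Real.sqrt (ρ ^ 2 - 1) := Real.sqrt_nonneg _
  have ha2 : Real.sqrt (ρ ^ 2 - 1) ^ 2 = ρ ^ 2 - 1 := Real.sq_sqrt (by nlinarith)
  have hkey : ‖z - c‖ * Real.sqrt (ρ ^ 2 - 1) < ρ * inner ℝ u (z - c) := by
    nlinarith [sq_nonneg (Real.sqrt (ρ ^ 2 - 1) - ‖z - c‖)]
  unfold InnerProductGeometry.angle
  apply Real.arccos_le_arccos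
  rw [hu, mul_one, real_inner_comm, div_le_div_iff₀ hρ0 hs]
  nlinarith

/-! ### §43.3 `BallCoveringBound n ρ` from the cap-AREA bound (PROVED) -/

/-- **CAP-AREA COVERING BOUND.**  If `n · (1 − √(ρ²−1)/ρ) < 2` and `ρ ≥ 1`, then `n` points never come
within `< 1` of every point of a sphere of radius `ρ`: the `n` caps of angular radius
`arccos (√(ρ²−1)/ρ)` about the directions of the points would cover `S²` with total normalised area
`n · (1 − √(ρ²−1)/ρ)/2 < 1`. -/
theorem ballCoveringBound_of_capArea {n : ℕ} {ρ : ℝ} (hρ : 1 ≤ ρ)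
    (harea : (n : ℝ) * (1 - Real.sqrt (ρ ^ 2 - 1) / ρ) < 2) : BallCoveringBound n ρ := by
  intro c Z hZ
  by_contra hcon
  push Not at hcon
  have hρ0 : 0 < ρ := by linarith
  set t : ℝ := Real.sqrt (ρ ^ 2 - 1) / ρ with ht
  have ht1 : t ≤ 1 := by
    rw [ht, div_le_one hρ0]
    calc Real.sqrt (ρ ^ 2 - 1) ≤ Real.sqrt (ρ ^ 2) := Real.sqrt_le_sqrt (by linarith)
      _ = ρ := Real.sqrt_sq hρ0.le
  have ht0 : 0 ≤ t := div_nonneg (Real.sqrt_nonneg _) hρ0.le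
  have hcos : Real.cos (Real.arccos t) = t := Real.cos_arccos (by linarith) ht1
  set Z' : Finset (EuclideanSpace ℝ (Fin 3)) := Z.filter (fun z => z ≠ c) with hZ'
  have hcover : {x : EuclideanSpace ℝ (Fin 3) | ‖x‖ = 1} ⊆
      ⋃ z ∈ Z', sphCap (‖z - c‖⁻¹ • (z - c)) (Real.arccos t) := by
    intro u hu
    have hu' : ‖u‖ = 1 := hu
    obtain ⟨z, hz, hd⟩ := hcon (c + ρ • u) (by
      rw [dist_eq_norm, add_sub_cancel_left, norm_smul, Real.norm_eq_abs, abs_of_pos hρ0, hu', mul_one])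
    obtain ⟨hw0, hang⟩ := angle_le_arccos_of_dist_lt_one hρ hu' hd
    have hzc : z ≠ c := fun hzc => hw0 (by rw [hzc, sub_self])
    refine mem_iUnion₂.2 ⟨z, Finset.mem_filter.2 ⟨hz, hzc⟩, hu', ?_⟩
    rw [InnerProductGeometry.angle_smul_left_of_pos _ _ (inv_pos.2 (norm_pos_iff.2 hw0))]
    exact hang
  have hsum := sphereFraction_le_sum_of_cover Z' hcover
  rw [sphereFraction_sphere] at hsum
  have hcap : ∀ z ∈ Z', sphereFraction (sphCap (‖z - c‖⁻¹ • (z - c)) (Real.arccos t)) = (1 - t) / 2 := by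
    intro z hz
    have hw0 : z - c ≠ 0 := sub_ne_zero.2 (Finset.mem_filter.1 hz).2
    have hdir : ‖‖z - c‖⁻¹ • (z - c)‖ = 1 := by
      rw [norm_smul, norm_inv, norm_norm, inv_mul_cancel₀ (norm_ne_zero_iff.2 hw0)]
    rw [sphereFraction_sphCap hdir (Real.arccos_nonneg _) (Real.arccos_le_pi _), hcos]
  rw [Finset.sum_congr rfl hcap, Finset.sum_const, nsmul_eq_mul] at hsum
  have hcard : (Z'.card : ℝ) ≤ n := by
    exact_mod_cast (Finset.card_filter_le _ _).trans hZ
  have h1t : 0 ≤ 1 - t := by linarith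
  have : (Z'.card : ℝ) * ((1 - t) / 2) ≤ (n : ℝ) * ((1 - t) / 2) :=
    mul_le_mul_of_nonneg_right hcard (by linarith)
  linarith

/-- The polynomial form for eleven points: `ρ² > 121/40` (`= 3.025`, i.e. `ρ > 1.7393`) suffices. -/
theorem ballCoveringBound_eleven_of_sq {ρ : ℝ} (hρ : 1 ≤ ρ) (h : 121 / 40 < ρ ^ 2) :
    BallCoveringBound 11 ρ := by
  apply ballCoveringBound_of_capArea hρ
  have hρ0 : 0 < ρ := by linarith
  have hs : 9 * ρ / 11 < Real.sqrt (ρ ^ 2 - 1) := by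
    rw [Real.lt_sqrt (by positivity)]
    nlinarith
  have h9 : 9 / 11 < Real.sqrt (ρ ^ 2 - 1) / ρ := by
    rw [lt_div_iff₀ hρ0]
    linarith
  push_cast
  linarith

/-- **`BallCoveringBound 11 (7/4)` (PROVED)** — `(7/4)² = 49/16 > 121/40`. -/
theorem ballCoveringBound_eleven_seven_quarters : BallCoveringBound 11 (7 / 4) :=
  ballCoveringBound_eleven_of_sq (by norm_num) (by norm_num)

/-- **★ THE AREA RUNG IS A THEOREM: `NoLooseChunksF (59/20)`** (g32's `noLooseChunksF_2p95_of_area` made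
unconditional; the proved top of the floor-7/10 ladder drops `63/20 → 59/20`). -/
theorem noLooseChunksF_areaTop : NoLooseChunksF (59 / 20) :=
  noLooseChunksF_2p95_of_area ballCoveringBound_eleven_seven_quarters

/-- The general area rung: `NLC_F(δ)` for every `δ` with `(1+δ)·(7/10) ≥ 1 + ρ`, `ρ² > 121/40`, `1 ≤ ρ ≤ 2`. -/
theorem noLooseChunksF_area {ρ δ : ℝ} (h : 121 / 40 < ρ ^ 2) (hρ1 : 1 ≤ ρ) (hρ2 : ρ ≤ 2)
    (hδ : 1 + ρ ≤ (1 + δ) * (7 / 10)) : NoLooseChunksF δ :=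
  noLooseChunksF_of_ballCoveringBound (ballCoveringBound_eleven_of_sq hρ1 h) hρ1 hρ2 hδ

/-- Sharpest two-decimal grid value of the area method: `NoLooseChunksF (73/25)` (`ρ = 218/125 = 1.744`). -/
theorem noLooseChunksF_area_grid : NoLooseChunksF (73 / 25) :=
  noLooseChunksF_area (ρ := 218 / 125) (by norm_num) (by norm_num) (by norm_num) (by norm_num)

/-- The band `(59/20, 63/20)` of g32's top piece is DISCHARGED. -/
theorem bandExclusionF_areaBand : BandExclusionF (59 / 20) (63 / 20) :=
  bandExclusionF_of_noLooseChunksF noLooseChunksF_areaTop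

/-- The area rung hands down every band above it. -/
theorem bandExclusionF_area (δ₂ : ℝ) : BandExclusionF (59 / 20) δ₂ :=
  bandExclusionF_of_noLooseChunksF noLooseChunksF_areaTop

/-! ### §43.4 The top piece of the cut re-based: `BAND_F(2, 59/20)` and its Fejes Tóth sub-band (EXACT) -/

/-- `BAND_F(2, 63/20) ↔ BAND_F(2, 59/20)` (both are `NLC_F(2)`, the tops being theorems). -/
theorem bandExclusionF_two_top_iff : BandExclusionF 2 (63 / 20) ↔ BandExclusionF 2 (59 / 20) := by
  rw [bandExclusionF_two_iff_noLooseChunksF_two]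
  have e : NoLooseChunksF 2 ↔ NoLooseChunksF (59 / 20) ∧ BandExclusionF 2 (59 / 20) :=
    noLooseChunksF_iff_band (by norm_num)
  rw [e]
  exact ⟨fun h => h.2, fun h => ⟨noLooseChunksF_areaTop, h⟩⟩

/-- `BAND_F(2, 59/20) ↔ NLC_F(2)`. -/
theorem bandExclusionF_two_59_iff_noLooseChunksF_two : BandExclusionF 2 (59 / 20) ↔ NoLooseChunksF 2 := by
  rw [← bandExclusionF_two_top_iff, bandExclusionF_two_iff_noLooseChunksF_two]

/-- EXACT sub-split of the top piece on the grid `2 < 11/4 < 59/20`: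
`BAND_F(2, 59/20) ↔ BAND_F(2, 11/4) ∧ BAND_F(11/4, 59/20)`; the second factor is the Fejes Tóth sub-band. -/
theorem bandExclusionF_two_59_iff :
    BandExclusionF 2 (59 / 20) ↔ BandExclusionF 2 (11 / 4) ∧ BandExclusionF (11 / 4) (59 / 20) := by
  rw [bandExclusionF_two_59_iff_noLooseChunksF_two]
  have e4 : NoLooseChunksF 2 ↔ NoLooseChunksF (11 / 4) ∧ BandExclusionF 2 (11 / 4) := noLooseChunksF_iff_band (by norm_num)
  have e5 : NoLooseChunksF (11 / 4) ↔ NoLooseChunksF (59 / 20) ∧ BandExclusionF (11 / 4) (59 / 20) :=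
    noLooseChunksF_iff_band (by norm_num)
  constructor
  · intro n2
    obtain ⟨n3, b23⟩ := e4.mp n2
    exact ⟨b23, (e5.mp n3).2⟩
  · rintro ⟨b23, b34⟩
    exact e4.mpr ⟨e5.mpr ⟨noLooseChunksF_areaTop, b34⟩, b23⟩

/-- The Fejes Tóth sub-band from the covering fact: `BallCoveringBound 11 (8/5) → BAND_F(11/4, 59/20)`. -/
theorem bandExclusionF_fejesTothBand (hE : BallCoveringBound 11 (8 / 5)) : BandExclusionF (11 / 4) (59 / 20) :=
  bandExclusionF_of_noLooseChunksF (noLooseChunksF_2p75_of_fejesToth hE)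

/-- With the Fejes Tóth covering bound granted, the top piece is `BAND_F(2, 11/4)` exactly. -/
theorem bandExclusionF_two_59_iff_of_fejesToth (hE : BallCoveringBound 11 (8 / 5)) :
    BandExclusionF 2 (59 / 20) ↔ BandExclusionF 2 (11 / 4) := by
  rw [bandExclusionF_two_59_iff]
  exact ⟨fun h => h.1, fun h => ⟨h, bandExclusionF_fejesTothBand hE⟩⟩

/-- **THE CUT OF RECORD after g33 (EXACT, 0 EQUIV)**: the residual `NoLooseChunks` ↔ six band pieces with
the proved top now at `59/20`. -/
theorem noLooseChunks_iff_ladderF6' :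
    NoLooseChunks ↔ BandExclusionF (3 / 50) (3 / 20) ∧ BandExclusionF (3 / 20) (1 / 4) ∧ BandExclusionF (1 / 4) (1 / 2) ∧
      BandExclusionF (1 / 2) 1 ∧ BandExclusionF 1 2 ∧ BandExclusionF 2 (59 / 20) := by
  rw [noLooseChunks_iff_ladderF6, bandExclusionF_two_top_iff]

/-- Six pieces ⟹ the residual. -/
theorem noLooseChunks_of_ladderF6' (hB₀ : BandExclusionF (3 / 50) (3 / 20)) (hB₁ : BandExclusionF (3 / 20) (1 / 4))
    (hB₂ : BandExclusionF (1 / 4) (1 / 2)) (hB₃ : BandExclusionF (1 / 2) 1) (hB₄ : BandExclusionF 1 2)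
    (hB₅ : BandExclusionF 2 (59 / 20)) : NoLooseChunks :=
  noLooseChunks_iff_ladderF6'.mpr ⟨hB₀, hB₁, hB₂, hB₃, hB₄, hB₅⟩

/-- The residual ⟹ each of the six pieces (each is WEAKER by name). -/
theorem ladderF6'_of_noLooseChunks (h : NoLooseChunks) :
    BandExclusionF (3 / 50) (3 / 20) ∧ BandExclusionF (3 / 20) (1 / 4) ∧ BandExclusionF (1 / 4) (1 / 2) ∧
      BandExclusionF (1 / 2) 1 ∧ BandExclusionF 1 2 ∧ BandExclusionF 2 (59 / 20) :=
  noLooseChunks_iff_ladderF6'.mp h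

/-! ### §43.5 The rung family `BallCoveringBound n ρ` is an UP-SET in `ρ` (threshold radius) -/

/-- **Monotonicity in the radius**: if `n` points can come within `< 1` of all of `S(c, ρ')` then, shrinking
the configuration about `c`, `n` points come within `< 1` of all of `S(c, ρ)` for `0 < ρ ≤ ρ'`; i.e.
`BallCoveringBound n ρ → BallCoveringBound n ρ'`. -/
theorem ballCoveringBound_mono {n : ℕ} {ρ ρ' : ℝ} (hρ : 0 < ρ) (hle : ρ ≤ ρ') (h : BallCoveringBound n ρ) :
    BallCoveringBound n ρ' := by
  intro c Z' hZ'
  have hρ' : 0 < ρ' := lt_of_lt_of_le hρ hle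
  set s : ℝ := ρ / ρ' with hs
  have hs0 : 0 < s := div_pos hρ hρ'
  have hs1 : s ≤ 1 := (div_le_one hρ').2 hle
  let f : EuclideanSpace ℝ (Fin 3) → EuclideanSpace ℝ (Fin 3) := fun z => c + s • (z - c)
  obtain ⟨x, hxc, hxZ⟩ := h c (Z'.image f) (Finset.card_image_le.trans hZ')
  refine ⟨c + s⁻¹ • (x - c), ?_, fun z' hz' => ?_⟩
  · rw [dist_eq_norm, add_sub_cancel_left, norm_smul, Real.norm_eq_abs, abs_of_pos (inv_pos.2 hs0),
      ← dist_eq_norm, hxc, hs, inv_div, div_mul_cancel₀ _ hρ.ne']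
  · have h1 := hxZ (f z') (Finset.mem_image_of_mem f hz')
    have hxz : dist (c + s⁻¹ • (x - c)) z' = s⁻¹ * dist x (f z') := by
      have : c + s⁻¹ • (x - c) - z' = s⁻¹ • (x - f z') := by
        simp only [f, smul_sub, smul_add, smul_smul, inv_mul_cancel₀ hs0.ne', one_smul]
        abel
      rw [dist_eq_norm, this, norm_smul, Real.norm_eq_abs, abs_of_pos (inv_pos.2 hs0), ← dist_eq_norm]
    rw [hxz]
    have hinv : 1 ≤ s⁻¹ := one_le_inv_iff₀.2 ⟨hs0, hs1⟩
    nlinarith [dist_nonneg (x := x) (y := f z')]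

/-- Corollary: `BallCoveringBound 11 ρ` for EVERY `ρ ≥ 7/4` (the up-set above the area threshold). -/
theorem ballCoveringBound_eleven_of_ge {ρ : ℝ} (hρ : 7 / 4 ≤ ρ) : BallCoveringBound 11 ρ :=
  ballCoveringBound_mono (by norm_num) hρ ballCoveringBound_eleven_seven_quarters

/-! ### §43.6 The METHOD FLOOR: six points 1-cover `S(c, 6/5)` (octahedron of radius 7/10), so the single-sphere
covering reduction is void at `ρ ≤ 6/5`, i.e. for slack `(1+δ)·(7/10) ≤ 11/5` (`δ ≤ 15/7 ≈ 2.143`) -/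

/-- `BallCoveringBound` is ANTITONE in `n` (fewer points are easier to escape). -/
theorem ballCoveringBound_anti {m n : ℕ} (hmn : m ≤ n) {ρ : ℝ} (h : BallCoveringBound n ρ) :
    BallCoveringBound m ρ :=
  fun c Z hZ => h c Z (hZ.trans hmn)

/-- **The octahedral six-covering**: `¬ BallCoveringBound 6 (6/5)` — the six points `±(7/10)·eᵢ` come within `< 1`
of every point of the sphere of radius `6/5` about the origin (a point `v` of that sphere has a coordinate with
`vᵢ² ≥ 12/25`, and then `‖v ∓ (7/10)eᵢ‖² = 193/100 − (7/5)|vᵢ| < 1`). -/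
theorem not_ballCoveringBound_six : ¬ BallCoveringBound 6 (6 / 5) := by
  intro h
  let e : Fin 3 → ℝ → EuclideanSpace ℝ (Fin 3) := fun i a => EuclideanSpace.single i a
  let Z : Finset (EuclideanSpace ℝ (Fin 3)) :=
    (Finset.univ.image fun i : Fin 3 => e i (7 / 10)) ∪ (Finset.univ.image fun i : Fin 3 => e i (-(7 / 10)))
  have hZ : Z.card ≤ 6 := by
    refine (Finset.card_union_le _ _).trans ?_
    have h1 : (Finset.univ.image fun i : Fin 3 => e i (7 / 10)).card ≤ 3 :=
      Finset.card_image_le.trans (by simp)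
    have h2 : (Finset.univ.image fun i : Fin 3 => e i (-(7 / 10))).card ≤ 3 :=
      Finset.card_image_le.trans (by simp)
    omega
  obtain ⟨x, hxc, hxZ⟩ := h 0 Z hZ
  -- coordinates of x
  have hsq : ∑ i, (x i) ^ 2 = (6 / 5) ^ 2 := by
    rw [← hxc, EuclideanSpace.dist_sq_eq]
    simp
  have hmemp : ∀ i : Fin 3, e i (7 / 10) ∈ Z := fun i =>
    Finset.mem_union_left _ (Finset.mem_image_of_mem _ (Finset.mem_univ i))
  have hmemn : ∀ i : Fin 3, e i (-(7 / 10)) ∈ Z := fun i =>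
    Finset.mem_union_right _ (Finset.mem_image_of_mem _ (Finset.mem_univ i))
  -- squared distance to ±(7/10)eᵢ
  have hd : ∀ (i : Fin 3) (a : ℝ), dist x (e i a) ^ 2 = (6 / 5) ^ 2 - 2 * a * x i + a ^ 2 := by
    intro i a
    rw [EuclideanSpace.dist_sq_eq, ← hsq]
    simp only [e, Real.dist_eq, sq_abs]
    rw [Fin.sum_univ_three, Fin.sum_univ_three]
    fin_cases i <;> simp <;> ring
  -- every coordinate is small in absolute value, else the matching octahedron vertex is within < 1
  have hsmall : ∀ i : Fin 3, (x i) ^ 2 < 12 / 25 := by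
    intro i
    by_contra hge
    rw [not_lt] at hge
    rcases le_or_gt 0 (x i) with hpos | hneg
    · have h1 := hxZ (e i (7 / 10)) (hmemp i)
      have h1' : 1 ≤ dist x (e i (7 / 10)) ^ 2 := by nlinarith
      rw [hd] at h1'
      nlinarith
    · have h1 := hxZ (e i (-(7 / 10))) (hmemn i)
      have h1' : 1 ≤ dist x (e i (-(7 / 10))) ^ 2 := by nlinarith
      rw [hd] at h1'
      nlinarith
  have h3 := hsmall 0
  have h4 := hsmall 1
  have h5 := hsmall 2
  rw [Fin.sum_univ_three] at hsq
  linarith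

/-- Hence `¬ BallCoveringBound 11 ρ` for every `0 < ρ ≤ 6/5`. -/
theorem not_ballCoveringBound_eleven_of_le {ρ : ℝ} (hρ0 : 0 < ρ) (hρ : ρ ≤ 6 / 5) : ¬ BallCoveringBound 11 ρ :=
  fun h => not_ballCoveringBound_six (ballCoveringBound_anti (by norm_num) (ballCoveringBound_mono hρ0 hρ h))

/-- **METHOD FLOOR (PROVED)**: the hypothesis of the sphere-covering reduction `noLooseChunksF_of_ballCoveringBound`
is unsatisfiable at slack `δ ≤ 15/7`: `1 + ρ ≤ (1+δ)·(7/10) ≤ 11/5` forces `ρ ≤ 6/5`. -/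
theorem sphereCovering_reduction_void {δ ρ : ℝ} (hδ : (1 + δ) * (7 / 10) ≤ 11 / 5) (hρ1 : 1 ≤ ρ)
    (hred : 1 + ρ ≤ (1 + δ) * (7 / 10)) : ¬ BallCoveringBound 11 ρ :=
  not_ballCoveringBound_eleven_of_le (by linarith) (by linarith)

end Summit.AtomisticToContinuum.Crystallization.Theorems.ContactSaturationLadderAreaTop
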